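import Literature.Computability.Cryptography.ShorProofs
import Literature.Computability.Complexity.CanonicalCodes
import Literature.Computability.Complexity.ListFoldChecks
import HarnessLib

/-!
# `factPost ∈ FP`: discharge of the programming fact `factPost_mem_FP` of `ShorProofs.lean`

Family `PQC`, companion of `Literature/Computability/Cryptography/ShorProofs.lean`. That file
reduces `FACT ∈ BQP` (Shor 1997, §5, decision form) to Shor's factoring theorem and to two
*programming facts*, the membership in `FP` of the classical pre- and post-processors of the
decision version; the post-processor fact `Literature.Computability.Cryptography.factPost_mem_FP`
(`factPost ∈ FP`) is discharged here: **`factPost_mem_FP_holds`**.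

`factPost z` (`ShorProofs.lean`) reads `z = ⟨x, y⟩` (`boolUnpair`), decodes the instance `x`
with `natPairEncoding = encodingNatBool.pairBool encodingNatBool` as `(N, k)`, checks that `x`
*is* the canonical code of `(N, k)` (answer `[0]` otherwise), decodes the list `L` of naturals
coded by `y` with `encodingListNatBool` and answers `[factAnswer N k L]`
(`N = 0`: `[2 ≤ k]`; `N ≥ 1`: `[∃ p ∈ L, p ≤ k]`). Both decoders are TOTAL (Mathlib's
`encodingNatBool.decode = some ∘ decodeNat`, the list decoder reads `|header|` items with
`boolUnpair`), so `factPost` has a closed form on *every* string (`factPost_eq`), and that closed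
form is assembled from the tree's algebra of `FP` bricks — no machine is written:

* the canonical-instance test is the string-equality brick `eqPairFn` (`StringEquality.lean`)
  applied to `⟨canonPairFn canonF canonF x, x⟩`, where `CanonCode.canonPairFn`/`Brick.canonF`
  (`CanonicalCodes.lean`, `FoldBricks.lean`) compute `encode ∘ decode` of the pair code
  (`CanonCode.canonPairFn_eq`);
* `N = 0` is `Brick.isNilFn` on the first field, `[2 ≤ k]` is `Brick.valGeTwoFn` on the second
  (`StackBricks.lean`; on the canonical branch the fields are canonical numerals, read by
  `bitsToNat_encodeNat`);
* `[∃ p ∈ L, p ≤ k]` is `Brick.anyFn (notFn ltFn)` (`ListFoldBricks.lean`) run on `⟨⌜k⌝, items⟩`,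
  where `items` is the item part of the *re-encoded* list `canonListFn canonF y = encode (decode y)`
  (`CanonCode.canonListFn_eq`): on a genuine code the fold's parser `Brick.decNil` returns exactly
  the canonical numerals of `L` (`listBool_encode_eq_encList`, `Brick.decNil_encList`), whereas on
  the raw `y` it would parse malformed strings differently from `listBoolDecode`;
* the three cases are glued by `iteFn` (`BranchingFn.lean`), and membership in `FP` is closure
  under composition, fan-out and branching (`comp_mem_FP`, `fanoutFn_mem_FP`, `iteFn_mem_FP`).

The composites are written out in the statements (no new definitions are introduced); the
docstrings call them `instOk` (instance test), `someLe` (the `N ≥ 1` answer) and `factPostF`.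

## References

* S. Arora, B. Barak, *Computational Complexity: A Modern Approach*, CUP 2009 [AroraBarakCC2009]:
  §0.1 "Representing pairs and tuples" (p. 2: the code `0 ↦ 00, 1 ↦ 11, # ↦ 01` of `⟨x, y⟩`, which
  is the tree's `boolPair`), Theorem 2.8 and its proof (pp. 42–43: polynomial-time computable
  functions compose), §1.3 (robustness of polynomial time; bounded loops).
* P. W. Shor, *Polynomial-time algorithms for prime factorization and discrete logarithms on a
  quantum computer*, SIAM J. Comput. 26 (1997) 1484–1509, §5 (the theorem this post-processor
  serves) [Shor1997].

## Design notes

* Nothing of `ShorProofs.lean` is restated: `factPost`, `factAnswer`, `natPairEncoding` are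
  imported; the fact `factPost_mem_FP` keeps its meaning and is proved as stated.
* The sibling `ShorFactPost.lean` realises *a different* post-processor (a stack register
  program `FactPost.prog`, specified on the promise only); it is not extensionally equal to
  `factPost` off the promise (it inspects the first listed prime only), so it cannot discharge
  this fact and is not imported.
-/

noncomputable section

namespace Literature.Computability.Cryptography

open _root_.Computability Complexity Brick CanonCode

namespace FactPostFP

/-! ### The decoders of `factPost` are total -/

/-- Mathlib's `encodingNatBool` encodes by `encodeNat` (definitional). [folklore] -/
theorem encodingNatBool_encode (n : ℕ) : encodingNatBool.encode n = encodeNat n := rfl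

/-- The code of a pair of naturals is the `boolPair` of the binary numerals (definitional).
[cite: AroraBarakCC2009, §0.1 (Representing pairs and tuples, p. 2)] -/
theorem natPairEncoding_encode (N k : ℕ) :
    natPairEncoding.encode (N, k) = boolPair (encodeNat N) (encodeNat k) := rfl

/-- **The instance decoder is total** and its re-encoding is the brick
`canonPairFn canonF canonF` (`CanonCode.canonPairFn_eq` with `Brick.canonF = encodeNat ∘ decodeNat`).
[folklore] -/
theorem natPairEncoding_decode (x : List Bool) :
    natPairEncoding.decode x = some (decodeNat (boolUnpair x).1, decodeNat (boolUnpair x).2) ∧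
      canonPairFn canonF canonF x =
        natPairEncoding.encode (decodeNat (boolUnpair x).1, decodeNat (boolUnpair x).2) :=
  canonPairFn_eq encodingNatBool encodingNatBool decodeNat decodeNat (fun _ => rfl) (fun _ => rfl)
    canonF_eq_encodeNat_decodeNat canonF_eq_encodeNat_decodeNat x

/-- **The list decoder is total** — the list of naturals read off ANY string `y` by
`encodingListNatBool.decode` is `NegCNF.decList decodeNat |(boolUnpair y).1| (boolUnpair y).2`
(as many items as the length of the header, split off the body with `boolUnpair` and read by
`decodeNat`) — and its re-encoding is the brick `canonListFn canonF` (`CanonCode.canonListFn_eq`).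
[folklore] -/
theorem encodingListNatBool_decode (y : List Bool) :
    encodingListNatBool.decode y =
        some (NegCNF.decList decodeNat (boolUnpair y).1.length (boolUnpair y).2) ∧
      canonListFn canonF y = encodingListNatBool.encode
        (NegCNF.decList decodeNat (boolUnpair y).1.length (boolUnpair y).2) :=
  canonListFn_eq encodingNatBool decodeNat (fun _ => rfl) canonF_eq_encodeNat_decodeNat y

/-- **Closed form of `factPost` on every string**: with `x = (boolUnpair z).1`,
`y = (boolUnpair z).2`, `N = decodeNat (boolUnpair x).1`, `k = decodeNat (boolUnpair x).2`:
if `x` is the canonical code `⟨⌜N⌝, ⌜k⌝⟩` then `[factAnswer N k L]` with `L` the list read off `y`,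
else `[0]`. [folklore] -/
theorem factPost_eq (z : List Bool) :
    factPost z =
      if natPairEncoding.encode (decodeNat (boolUnpair (boolUnpair z).1).1,
            decodeNat (boolUnpair (boolUnpair z).1).2) = (boolUnpair z).1 then
        [factAnswer (decodeNat (boolUnpair (boolUnpair z).1).1)
          (decodeNat (boolUnpair (boolUnpair z).1).2)
          (NegCNF.decList decodeNat (boolUnpair (boolUnpair z).2).1.length
            (boolUnpair (boolUnpair z).2).2)]
      else [false] := by
  unfold factPost
  rw [(natPairEncoding_decode (boolUnpair z).1).1, (encodingListNatBool_decode (boolUnpair z).2).1]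

/-! ### The bricks -/

/-- **The instance test** `instOk = eqPairFn ∘ fanoutFn (canonPairFn canonF canonF ∘ fstF) fstF`
(the string-equality brick on the fan-out `⟨canonPairFn canonF canonF x, x⟩`, `x = fstF z`):
its value on every string is `[canonPairFn canonF canonF x = x]`. [folklore] -/
theorem instOkF_apply (z : List Bool) :
    (eqPairFn ∘ fanoutFn (canonPairFn canonF canonF ∘ fstF) fstF) z =
      [decide (canonPairFn canonF canonF (fstF z) = fstF z)] := by
  simp [eqPairFn_boolPair]

/-- The instance test is in `FP`.
[cite: AroraBarakCC2009, Theorem 2.8 (proof: composition, pp. 42–43)] -/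
theorem instOkF_mem_FP : (eqPairFn ∘ fanoutFn (canonPairFn canonF canonF ∘ fstF) fstF) ∈ FP :=
  comp_mem_FP eqPairFn_mem_FP
    (fanoutFn_mem_FP (comp_mem_FP (canonPairFn_mem_FP canonF_mem_FP canonF_mem_FP) fstF_mem_FP)
      fstF_mem_FP)

/-- The item test `⟨q, a⟩ ↦ [⟦a⟧ ≤ ⟦q⟧]` is `notFn ltFn`. [folklore] -/
theorem notFn_ltFn_boolPair (q a : List Bool) :
    notFn ltFn (boolPair q a) = [decide (bitsToNat a ≤ bitsToNat q)] := by
  rw [notFn_apply (ltFn_boolPair q a)]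
  by_cases h : bitsToNat a ≤ bitsToNat q
  · simp [h, Nat.not_lt.2 h]
  · simp [h, Nat.lt_of_not_le h]

/-- **The `N ≥ 1` answer**
`someLe = anyFn (notFn ltFn) ∘ fanoutFn (sndF ∘ fstF) (sndF ∘ canonListFn canonF ∘ sndF)`
(`anyFn` of the one-bit test `⟦item⟧ ≤ ⟦k⟧` on `⟨second field of the instance, item part of the
re-encoded list⟩`) is in `FP` (`canonListFn` of the additively bounded `canonF`).
[cite: AroraBarakCC2009, Theorem 2.8 (proof: composition, pp. 42–43) and §1.3] -/
theorem someLeF_mem_FP :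
    (anyFn (notFn ltFn) ∘ fanoutFn (sndF ∘ fstF) (sndF ∘ canonListFn canonF ∘ sndF)) ∈ FP :=
  comp_mem_FP (anyFn_mem_FP (notFn_mem_FP ltFn_mem_FP) (oneBit_notFn oneBit_ltFn))
    (fanoutFn_mem_FP (comp_mem_FP sndF_mem_FP fstF_mem_FP)
      (comp_mem_FP sndF_mem_FP
        (comp_mem_FP (canonListFn_mem_FP canonF_mem_FP length_canonF_le) sndF_mem_FP)))

/-- **Value of `someLe` on every string**: `[∃ p ∈ L, p ≤ ⟦sndF (fstF z)⟧]`, `L` the list read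
off `sndF z`.
The re-encoded list is a genuine code, on which the fold's parser `decNil` returns the canonical
numerals of the items. [folklore] -/
theorem someLeF_apply (z : List Bool) :
    (anyFn (notFn ltFn) ∘ fanoutFn (sndF ∘ fstF) (sndF ∘ canonListFn canonF ∘ sndF)) z =
      [decide (∃ p ∈ NegCNF.decList decodeNat (boolUnpair (sndF z)).1.length (boolUnpair (sndF z)).2,
        p ≤ bitsToNat (sndF (fstF z)))] := by
  simp only [Function.comp_apply, fanoutFn_apply]
  rw [(encodingListNatBool_decode (sndF z)).2, listBool_encode_eq_encList, sndF_boolPair,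
    anyFn_boolPair (oneBit_notFn oneBit_ltFn), decNil_encList]
  have key : (∃ a ∈ List.map encodingNatBool.encode
        (NegCNF.decList decodeNat (boolUnpair (sndF z)).1.length (boolUnpair (sndF z)).2),
      notFn ltFn (boolPair (sndF (fstF z)) a) = [true]) ↔
      ∃ p ∈ NegCNF.decList decodeNat (boolUnpair (sndF z)).1.length (boolUnpair (sndF z)).2,
        p ≤ bitsToNat (sndF (fstF z)) := by
    constructor
    · rintro ⟨a, ha, h⟩
      obtain ⟨p, hp, rfl⟩ := List.mem_map.1 ha
      refine ⟨p, hp, ?_⟩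
      simpa [notFn_ltFn_boolPair, encodingNatBool_encode, bitsToNat_encodeNat] using h
    · rintro ⟨p, hp, hpk⟩
      refine ⟨encodeNat p, List.mem_map.2 ⟨p, hp, rfl⟩, ?_⟩
      simp [notFn_ltFn_boolPair, bitsToNat_encodeNat, hpk]
  rw [Bool.decide_congr key]

/-- **The brick computing `factPost`** — `factPostF = iteFn instOk (iteFn (isNilFn ∘ fstF ∘ fstF)
(valGeTwoFn ∘ sndF ∘ fstF) someLe) (fun _ => [0])`: branch on the instance test; on a canonical
instance branch on `N = 0` (`isNilFn` of the first field) between `[2 ≤ k]` (`valGeTwoFn` of the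
second field) and `someLe`; otherwise `[0]` — **is in `FP`**.
[cite: AroraBarakCC2009, Theorem 2.8 (proof: composition, pp. 42–43) and §1.3] -/
theorem factPostF_mem_FP :
    (iteFn (eqPairFn ∘ fanoutFn (canonPairFn canonF canonF ∘ fstF) fstF)
      (iteFn (isNilFn ∘ fstF ∘ fstF) (valGeTwoFn ∘ sndF ∘ fstF)
        (anyFn (notFn ltFn) ∘ fanoutFn (sndF ∘ fstF) (sndF ∘ canonListFn canonF ∘ sndF)))
      fun _ => [false]) ∈ FP :=
  iteFn_mem_FP instOkF_mem_FP
    (iteFn_mem_FP (comp_mem_FP isNilFn_mem_FP (comp_mem_FP fstF_mem_FP fstF_mem_FP))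
      (comp_mem_FP valGeTwoFn_mem_FP (comp_mem_FP sndF_mem_FP fstF_mem_FP)) someLeF_mem_FP)
    (const_mem_FP _)

/-- The brick `factPostF` (see `factPostF_mem_FP`) on a string whose instance field is a canonical
code `⟨⌜N⌝, ⌜k⌝⟩`. [folklore] -/
theorem factPostF_apply_of_eq (z : List Bool) (N k : ℕ)
    (hx : fstF z = boolPair (encodeNat N) (encodeNat k)) :
    (iteFn (eqPairFn ∘ fanoutFn (canonPairFn canonF canonF ∘ fstF) fstF)
      (iteFn (isNilFn ∘ fstF ∘ fstF) (valGeTwoFn ∘ sndF ∘ fstF)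
        (anyFn (notFn ltFn) ∘ fanoutFn (sndF ∘ fstF) (sndF ∘ canonListFn canonF ∘ sndF)))
      fun _ => [false]) z =
      [factAnswer N k
        (NegCNF.decList decodeNat (boolUnpair (sndF z)).1.length (boolUnpair (sndF z)).2)] := by
  have h1 : fstF (fstF z) = encodeNat N := by rw [hx, fstF_boolPair]
  have h2 : sndF (fstF z) = encodeNat k := by rw [hx, sndF_boolPair]
  have hok : (eqPairFn ∘ fanoutFn (canonPairFn canonF canonF ∘ fstF) fstF) z = [true] := by
    rw [instOkF_apply, hx, canonPairFn_apply, boolUnpair_boolPair]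
    simp [canonF_eq_encodeNat_decodeNat]
  -- `encodeNat N = [] ↔ N = 0` (cf. `encodeNat_eq_nil_iff`, `ZIntBricks.lean`, not importable here)
  have hnil : (encodeNat N = []) ↔ N = 0 :=
    ⟨fun h => by simpa [h] using (bitsToNat_encodeNat N).symm, fun h => by subst h; rfl⟩
  rw [iteFn_apply_true hok,
    iteFn_apply (c := isNilFn ∘ fstF ∘ fstF) (b := decide (N = 0))
      (by simp [isNilFn, Function.comp_apply, h1, hnil])]
  by_cases hN : N = 0
  · subst hN
    simp [valGeTwoFn, Function.comp_apply, h2, bitsToNat_encodeNat, factAnswer]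
  · rw [decide_eq_false hN]
    simp only [Bool.false_eq_true, if_false]
    rw [someLeF_apply, h2, bitsToNat_encodeNat, factAnswer, if_neg hN]

/-- The brick `factPostF` (see `factPostF_mem_FP`) on a string whose instance field is not a
canonical pair code. [folklore] -/
theorem factPostF_apply_of_ne (z : List Bool) (h : canonPairFn canonF canonF (fstF z) ≠ fstF z) :
    (iteFn (eqPairFn ∘ fanoutFn (canonPairFn canonF canonF ∘ fstF) fstF)
      (iteFn (isNilFn ∘ fstF ∘ fstF) (valGeTwoFn ∘ sndF ∘ fstF)
        (anyFn (notFn ltFn) ∘ fanoutFn (sndF ∘ fstF) (sndF ∘ canonListFn canonF ∘ sndF)))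
      fun _ => [false]) z = [false] := by
  have hok : (eqPairFn ∘ fanoutFn (canonPairFn canonF canonF ∘ fstF) fstF) z = [false] := by
    rw [instOkF_apply, decide_eq_false h]
  rw [iteFn_apply_false hok]

/-- **`factPostF = factPost`** (as total functions on all strings). [folklore] -/
theorem factPostF_eq_factPost :
    (iteFn (eqPairFn ∘ fanoutFn (canonPairFn canonF canonF ∘ fstF) fstF)
      (iteFn (isNilFn ∘ fstF ∘ fstF) (valGeTwoFn ∘ sndF ∘ fstF)
        (anyFn (notFn ltFn) ∘ fanoutFn (sndF ∘ fstF) (sndF ∘ canonListFn canonF ∘ sndF)))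
      fun _ => [false]) = factPost := by
  funext z
  rw [factPost_eq]
  have hcanon := (natPairEncoding_decode (fstF z)).2
  split_ifs with hx
  · exact factPostF_apply_of_eq z _ _ (hx.symm.trans (natPairEncoding_encode _ _))
  · exact factPostF_apply_of_ne z (fun h => hx (hcanon.symm.trans h))

end FactPostFP

/-- **Discharge of the programming fact `factPost_mem_FP`**: the classical post-processor of the
decision version of factoring (unpair; decode, re-encode and compare the instance; parse the
self-delimited factor list; compare its entries with `k`) is polynomial-time computable — it is
the composite `FP` brick written `factPostF` in this file (`FactPostFP.factPostF_eq_factPost`,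
`FactPostFP.factPostF_mem_FP`), a composition of
polynomial-time string functions with fan-outs and branches on computed bits.
[cite: AroraBarakCC2009, Theorem 2.8 (proof: composition, pp. 42–43) and §0.1 (pairs, p. 2)] -/
theorem factPost_mem_FP_holds : factPost_mem_FP := by
  rw [factPost_mem_FP, ← FactPostFP.factPostF_eq_factPost]
  exact FactPostFP.factPostF_mem_FP

end Literature.Computability.Cryptography

end
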